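import Literature.Computability.Cryptography.GoldreichLevinProgram
import Literature.Computability.Cryptography.GoldreichLevinTheorem
import HarnessLib

/-!
# The Goldreich–Levin theorem for hiding functions: discharge of `goldreichLevin_hiding`

Discharge of the named fact `goldreichLevin_hiding` (`GoldreichLevinHiding.lean`; Y. Liu, R. Pass,
FOCS 2020, Appendix A, Thm [GL89] "also see Theorem 2.12 in [HHR06]", for `𝒮`-hiding
`f : {0,1}ⁿ × {0,1}^{m(n)} → {0,1}^*`; O. Goldreich, *Foundations of Cryptography I*, Thm 2.5.6)
in full generality — **no proviso on the output length of `g`** (the fixed-length form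
`goldreichLevin_hiding_len` is `goldreichLevin_hiding_len_holds`, `GoldreichLevinHidingLenProofs.lean`).

The printed reduction is the tree's: the inverter `𝒜_GL = GLInv.alg` (`GoldreichLevinInverter.lean`,
polynomial time by `GLInv.glInvRun_polyTime_holds`, `GoldreichLevinProgram.lean`), Rackoff's list
decoding (`goldreich_levin_core`) and the XOR-lemma predictor (`GLPred.inverter_count`). Two points
differ from the fixed-length assembly (`GoldreichLevinTheorem.lean`):

* **The coin budget as advice on `(n, |y|)`.** `D`'s coin count on the sample
  `⟨1ⁿ, y ‖ σ ‖ u⟩` depends on `|y| = |g(x‖ρ)|`, which now varies over the seeds of one level. The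
  inverter's own input `⟨1ⁿ, y⟩` has length `2n + 2 + |y|`, and on a sparse sequence of good
  levels with spread `2n + 2 + maxLen(n)` (`maxLen` = the largest output length of `g` on the
  finitely many seeds of level `n`; `Yao.seqN` / `Yao.sel`) this length determines `(n, |y|)`; the
  budget `clT` hands `𝒜_GL` the count `Code(n, |y|) = κ(n,|y|) + K_b(n,|y|)·Room(n)` there, which
  `GLInv.run` decodes (`|coins| mod K_b(n, |y|)`, computed from the actual `|y|`).
* **Truncated coins in the analysis.** The math layer wants one coin type for the whole level: we
  take `{0,1}^{κ_m}`, `κ_m(n) = max` of `D`'s coin counts over the seeds, and let the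
  distinguisher-as-a-function read only the first `κ(n, |y|)` coins (`DfT`). Acceptance
  probabilities are unchanged (the fibres of truncation have size `2^{κ_m − κ}`:
  `pr_true_eq_card_take`, `card_filter_trunc`), so `GLPred.inverter_count` applies verbatim and the
  per-seed success counts bridge to `GLInv.card_success_ge`; the bound is the same
  `hidingProb ≥ δ/(4·2^K·2^k)` (`hidingProb_ge_gen`).

Main result: `goldreichLevin_hiding_holds : goldreichLevin_hiding`.

## References

* O. Goldreich, L. A. Levin, *A hard-core predicate for all one-way functions*, STOC 1989, 25–32.
* O. Goldreich, *Foundations of Cryptography I*, CUP 2001, §2.5.2–2.5.3, Thm 2.5.6.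
* I. Haitner, D. Harnik, O. Reingold, *On the power of the randomized iterate*, CRYPTO 2006,
  LNCS 4117, 22–40 (the Goldreich–Levin theorem for hiding functions, cited by Liu–Pass as
  "Theorem 2.12 in [HHR06]").
* Y. Liu, R. Pass, *On one-way functions and Kolmogorov complexity*, FOCS 2020
  (arXiv:2009.11514), Appendix A ("Hardcore functions and the Goldreich–Levin Theorem":
  Def. of `𝒮`-hiding for `f : {0,1}ⁿ × {0,1}^{m(n)} → {0,1}^*`, Thm [GL89]).
-/

namespace Literature.Computability.Cryptography

open Finset Matrix Filter Asymptotics _root_.Computability Complexity Complexity.Stockmeyer AffineStr GLEns GLDec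
  GLInv Polynomial

namespace GLGen

/-! ### Truncated coin strings -/

section Trunc

variable {κ κm : ℕ}

/-- The first `κ` coins of a coin string of length `κ_m ≥ κ`. [folklore] -/
def takeV (h : κ ≤ κm) (c : List.Vector Bool κm) : List.Vector Bool κ :=
  ⟨c.toList.take κ, by rw [List.length_take, List.Vector.toList_length, Nat.min_eq_left h]⟩

/-- `(takeV h c).toList = c.toList.take κ`. [folklore] -/
@[simp] theorem toList_takeV (h : κ ≤ κm) (c : List.Vector Bool κm) : (takeV h c).toList = c.toList.take κ := rfl

/-- **Sums through truncation**: `Σ_{c ∈ {0,1}^{κ_m}} F(c↾κ) = 2^{κ_m − κ} · Σ_{u ∈ {0,1}^κ} F(u)`. [folklore] -/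
theorem sum_take_eq {M : Type*} [AddCommMonoid M] (h : κ ≤ κm) (F : List Bool → M) :
    ∑ c : List.Vector Bool κm, F (c.toList.take κ) = 2 ^ (κm - κ) • ∑ u : List.Vector Bool κ, F u.toList := by
  obtain ⟨r, rfl⟩ := Nat.exists_eq_add_of_le h
  rw [Nat.add_sub_cancel_left, sum_vector_add (M := M) κ r (fun u _ => F u), Finset.smul_sum]
  refine Finset.sum_congr rfl fun u _ => ?_
  rw [Finset.sum_const, Finset.card_univ, card_vector, Fintype.card_bool]

/-- **Acceptance probability with truncated coins**: for `κ_m ≥ coinLen_D |z|`,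
`Pr[D(z) = 1] = #{c ∈ {0,1}^{κ_m} : D(z; c↾coinLen) = 1} / 2^{κ_m}`. [folklore] -/
theorem pr_true_eq_card_take (D : RandAlg (List Bool) Bool) (z : List Bool) (h : D.coinLen z.length ≤ κm) :
    D.pr id z {true} =
      ((univ.filter fun c : List.Vector Bool κm => D.run z (c.toList.take (D.coinLen z.length)) = true).card : ℝ) / 2 ^ κm := by
  classical
  obtain ⟨r, rfl⟩ := Nat.exists_eq_add_of_le h
  have hs := sum_take_eq (M := ℝ) h (fun l => if D.run z l = true then (1 : ℝ) else 0)
  simp only [Nat.add_sub_cancel_left] at hs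
  rw [pr_true_eq_card (D := D) z rfl, Finset.natCast_card_filter, Finset.natCast_card_filter, hs, nsmul_eq_mul, pow_add]
  push_cast
  field_simp

variable {n K : ℕ}

/-- Truncating `D`'s coin field of the predictor's coins `(J, β, ω', v, c)`. [folklore] -/
def truncCoins (h : κ ≤ κm) (ω : GLPred.Coins n K (List.Vector Bool κm)) : GLPred.Coins n K (List.Vector Bool κ) :=
  (ω.1, ω.2.1, ω.2.2.1, ω.2.2.2.1, takeV h ω.2.2.2.2)

/-- The predictor built from a distinguisher reading truncated coins is the predictor on truncated
coins. [folklore] -/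
theorem predB_trunc (h : κ ≤ κm) (Df : (Fin K → BVec n) → BVec K → List.Vector Bool κ → Bool)
    (ω : GLPred.Coins n K (List.Vector Bool κm)) (r : BVec n) :
    GLPred.predB (fun σ u c => Df σ u (takeV h c)) ω r = GLPred.predB Df (truncCoins h ω) r := rfl

/-- The coins with a field of length `κ + r` ≃ (coins with a field of length `κ`) × `{0,1}^r`. [folklore] -/
def coinsSplit (n K κ r : ℕ) (E : Type*) :
    GLPred.Coins n K (List.Vector Bool (κ + r)) × E ≃ (GLPred.Coins n K (List.Vector Bool κ) × E) × List.Vector Bool r where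
  toFun t := (((t.1.1, t.1.2.1, t.1.2.2.1, t.1.2.2.2.1, (vecSplitEquiv κ r t.1.2.2.2.2).1), t.2), (vecSplitEquiv κ r t.1.2.2.2.2).2)
  invFun p := ((p.1.1.1, p.1.1.2.1, p.1.1.2.2.1, p.1.1.2.2.2.1, (vecSplitEquiv κ r).symm (p.1.1.2.2.2.2, p.2)), p.1.2)
  left_inv t := by
    obtain ⟨⟨J, β, ω', v, c⟩, e⟩ := t
    simp only [Prod.mk.eta, Equiv.symm_apply_apply]
  right_inv p := by
    obtain ⟨⟨⟨J, β, ω', v, c'⟩, e⟩, w⟩ := p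
    simp only [Equiv.apply_symm_apply]

/-- **Fibre count of truncation**: `#{(ω, e) : P(trunc ω, e)} = 2^{κ_m − κ} · #{(ω', e) : P(ω', e)}` over
coin fields of length `κ_m` resp. `κ`. [folklore] -/
theorem card_filter_trunc {E : Type*} [Fintype E] (h : κ ≤ κm)
    (P : GLPred.Coins n K (List.Vector Bool κ) × E → Prop) [DecidablePred P] :
    (univ.filter fun t : GLPred.Coins n K (List.Vector Bool κm) × E => P (truncCoins h t.1, t.2)).card =
      2 ^ (κm - κ) * (univ.filter P).card := by
  classical
  obtain ⟨r, rfl⟩ := Nat.exists_eq_add_of_le h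
  rw [Nat.add_sub_cancel_left]
  have h1 : (univ.filter fun t : GLPred.Coins n K (List.Vector Bool (κ + r)) × E => P (truncCoins h t.1, t.2)).card =
      (univ.filter fun q : (GLPred.Coins n K (List.Vector Bool κ) × E) × List.Vector Bool r => P q.1).card := by
    refine Finset.card_equiv (coinsSplit n K κ r E) fun t => ?_
    simp only [Finset.mem_filter, Finset.mem_univ, true_and]
    exact Iff.rfl
  rw [h1, ← Finset.univ_product_univ, Finset.filter_product_left, Finset.card_product, Finset.card_univ, card_vector,
    Fintype.card_bool, mul_comm]

end Trunc

/-! ### The distinguisher with truncated coins and the acceptance counts of a level -/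

section Counts

variable (D : RandAlg (List Bool) Bool) (g : List Bool → List Bool) (S : ∀ n : ℕ, Finset (List.Vector Bool n))
  (kap : ℕ → ℕ) (n mm K κm : ℕ)

/-- **The distinguisher as a function of `(x, ρ, σ, v, c)` reading truncated coins**:
`D(1ⁿ, g(x‖ρ) ‖ blocks σ ‖ bits v; c↾kap(|g(x‖ρ)|))`, `c ∈ {0,1}^{κ_m}` (`kap(ℓ)` = `D`'s coin count on
the samples with `|y| = ℓ`). [Goldreich 2001, §2.5.3] [cite: Goldreich2001, Thm. 2.5.6 (proof, Section 2.5.3)] -/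
def DfT (x : ↥(S n)) (ρ : List.Vector Bool mm) (σ : Fin K → BVec n) (v : BVec K) (c : List.Vector Bool κm) : Bool :=
  D.run (boolPair (unaryEncodeNat n) (g (x.1.toList ++ ρ.toList) ++ blocksStr σ ++ encZ K v))
    (c.toList.take (kap (g (x.1.toList ++ ρ.toList)).length))

/-- The real acceptance count `Re = #{(x, ρ, σ, c) : D accepts the real sample}` (truncated coins). [folklore] -/
noncomputable def ReT : ℕ :=
  (univ.filter fun q : ↥(S n) × List.Vector Bool mm × (Fin K → BVec n) × List.Vector Bool κm =>
    DfT D g S kap n mm K κm q.1 q.2.1 q.2.2.1 (fun j => sec S n q.1 ⬝ᵥ q.2.2.1 j) q.2.2.2 = true).card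

/-- The ideal acceptance count `Id = #{(x, ρ, σ, v, c) : D accepts the ideal sample}` (truncated coins). [folklore] -/
noncomputable def IdT : ℕ :=
  (univ.filter fun q : ↥(S n) × List.Vector Bool mm × (Fin K → BVec n) × BVec K × List.Vector Bool κm =>
    DfT D g S kap n mm K κm q.1 q.2.1 q.2.2.1 q.2.2.2.1 q.2.2.2.2 = true).card

variable {D g S kap n mm K κm}

/-- **`Pr[D(1ⁿ, real) = 1] · (|S_n| 2^m 2^{Kn} 2^{κ_m}) = Re`** when `kap(|g(x‖ρ)|)` is `D`'s coin count on
the samples of the seed `(x, ρ)` and `κ_m` bounds these counts. [folklore] -/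
theorem prReal_mul_eq (hS : (S n).Nonempty)
    (hkap : ∀ x ∈ S n, ∀ ρ : List.Vector Bool mm,
      kap (g (x.toList ++ ρ.toList)).length = D.coinLen (2 * n + 2 + ((g (x.toList ++ ρ.toList)).length + K * n + K)))
    (hκm : ∀ x ∈ S n, ∀ ρ : List.Vector Bool mm, kap (g (x.toList ++ ρ.toList)).length ≤ κm) :
    (acceptPMF D n ((condUniform (blockSeeds S (mm + K * n) n)).map (glReal g mm K n)) true).toReal *
        ((S n).card * 2 ^ mm * 2 ^ (K * n) * 2 ^ κm) = ReT D g S kap n mm K κm := by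
  classical
  have hbS : (blockSeeds S (mm + K * n) n).Nonempty := blockSeeds_nonempty_iff.2 hS
  rw [toReal_acceptPMF_condUniform_map D n hbS, sum_blockSeeds_real, card_blockSeeds]
  -- each seed: the real sample and its acceptance count
  have hterm : ∀ x ∈ S n, ∀ (ρ : List.Vector Bool mm) (σ : Fin K → BVec n),
      D.pr id (boolPair (unaryEncodeNat n) (glReal g mm K n (x.toList ++ ρ.toList ++ blocksStr σ))) {true} =
        ((univ.filter fun c : List.Vector Bool κm => D.run (boolPair (unaryEncodeNat n)
          (g (x.toList ++ ρ.toList) ++ blocksStr σ ++ encZ K fun j => Stockmeyer.toZ x ⬝ᵥ σ j))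
            (c.toList.take (kap (g (x.toList ++ ρ.toList)).length)) = true).card : ℝ) / 2 ^ κm := by
    intro x hx ρ σ
    have hseed := glReal_seed g x ρ (blocksEquiv n K σ)
    rw [toList_blocksEquiv] at hseed
    rw [hseed, glBits_blocksStr]
    have hlen : (boolPair (unaryEncodeNat n) (g (x.toList ++ ρ.toList) ++ blocksStr σ ++
        encZ K fun j => Stockmeyer.toZ x ⬝ᵥ σ j)).length = 2 * n + 2 + ((g (x.toList ++ ρ.toList)).length + K * n + K) := by
      rw [length_boolPair, show (unaryEncodeNat n).length = n from unary_decode_encode_nat n, List.length_append,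
        List.length_append, length_blocksStr, length_encZ]
    have hk : D.coinLen (boolPair (unaryEncodeNat n) (g (x.toList ++ ρ.toList) ++ blocksStr σ ++
        encZ K fun j => Stockmeyer.toZ x ⬝ᵥ σ j)).length = kap (g (x.toList ++ ρ.toList)).length := by
      rw [hlen, hkap x hx ρ]
    rw [pr_true_eq_card_take (κm := κm) D _ (by rw [hk]; exact hκm x hx ρ), hk]
  rw [Finset.sum_congr rfl fun x hx => Finset.sum_congr rfl fun ρ _ => Finset.sum_congr rfl fun σ _ => hterm x hx ρ σ]
  -- the count as an iterated sum
  have hRe : (ReT D g S kap n mm K κm : ℝ) = ∑ x ∈ S n, ∑ ρ : List.Vector Bool mm, ∑ σ : Fin K → BVec n,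
      ((univ.filter fun c : List.Vector Bool κm => D.run (boolPair (unaryEncodeNat n)
          (g (x.toList ++ ρ.toList) ++ blocksStr σ ++ encZ K fun j => Stockmeyer.toZ x ⬝ᵥ σ j))
            (c.toList.take (kap (g (x.toList ++ ρ.toList)).length)) = true).card : ℝ) := by
    unfold ReT
    rw [Finset.natCast_card_filter, Fintype.sum_prod_type, ← Finset.sum_coe_sort (S n)]
    refine Finset.sum_congr rfl fun x _ => ?_
    rw [Fintype.sum_prod_type]
    refine Finset.sum_congr rfl fun ρ _ => ?_
    rw [Fintype.sum_prod_type]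
    refine Finset.sum_congr rfl fun σ _ => ?_
    rw [Finset.natCast_card_filter]
    rfl
  rw [hRe]
  have hS0 : ((S n).card : ℝ) ≠ 0 := by exact_mod_cast hS.card_pos.ne'
  simp only [← Finset.sum_div, Nat.cast_mul, Nat.cast_pow, Nat.cast_ofNat, pow_add]
  field_simp

/-- **`Pr[D(1ⁿ, ideal) = 1] · (|S_n| 2^m 2^{Kn} 2^K 2^{κ_m}) = Id`.** [folklore] -/
theorem prIdeal_mul_eq (hS : (S n).Nonempty)
    (hkap : ∀ x ∈ S n, ∀ ρ : List.Vector Bool mm,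
      kap (g (x.toList ++ ρ.toList)).length = D.coinLen (2 * n + 2 + ((g (x.toList ++ ρ.toList)).length + K * n + K)))
    (hκm : ∀ x ∈ S n, ∀ ρ : List.Vector Bool mm, kap (g (x.toList ++ ρ.toList)).length ≤ κm) :
    (acceptPMF D n ((condUniform (blockSeeds S (mm + K * n + K) n)).map (glIdeal g mm n)) true).toReal *
        ((S n).card * 2 ^ mm * 2 ^ (K * n) * 2 ^ K * 2 ^ κm) = IdT D g S kap n mm K κm := by
  classical
  have hbS : (blockSeeds S (mm + K * n + K) n).Nonempty := blockSeeds_nonempty_iff.2 hS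
  rw [toReal_acceptPMF_condUniform_map D n hbS, card_blockSeeds, Nat.add_assoc, sum_blockSeeds_ideal]
  have hterm : ∀ x ∈ S n, ∀ (ρ : List.Vector Bool mm) (σ : Fin K → BVec n) (v : BVec K),
      D.pr id (boolPair (unaryEncodeNat n) (glIdeal g mm n (x.toList ++ ρ.toList ++ blocksStr σ ++ encZ K v))) {true} =
        ((univ.filter fun c : List.Vector Bool κm => D.run (boolPair (unaryEncodeNat n)
          (g (x.toList ++ ρ.toList) ++ blocksStr σ ++ encZ K v))
            (c.toList.take (kap (g (x.toList ++ ρ.toList)).length)) = true).card : ℝ) / 2 ^ κm := by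
    intro x hx ρ σ v
    rw [List.append_assoc (x.toList ++ ρ.toList), glIdeal_seed g x ρ, ← List.append_assoc]
    have hlen : (boolPair (unaryEncodeNat n) (g (x.toList ++ ρ.toList) ++ blocksStr σ ++ encZ K v)).length =
        2 * n + 2 + ((g (x.toList ++ ρ.toList)).length + K * n + K) := by
      rw [length_boolPair, show (unaryEncodeNat n).length = n from unary_decode_encode_nat n, List.length_append,
        List.length_append, length_blocksStr, length_encZ]
    have hk : D.coinLen (boolPair (unaryEncodeNat n) (g (x.toList ++ ρ.toList) ++ blocksStr σ ++ encZ K v)).length =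
        kap (g (x.toList ++ ρ.toList)).length := by
      rw [hlen, hkap x hx ρ]
    rw [pr_true_eq_card_take (κm := κm) D _ (by rw [hk]; exact hκm x hx ρ), hk]
  rw [Finset.sum_congr rfl fun x hx => Finset.sum_congr rfl fun ρ _ => Finset.sum_congr rfl fun σ _ =>
    Finset.sum_congr rfl fun v _ => hterm x hx ρ σ v]
  have hId : (IdT D g S kap n mm K κm : ℝ) = ∑ x ∈ S n, ∑ ρ : List.Vector Bool mm, ∑ σ : Fin K → BVec n, ∑ v : BVec K,
      ((univ.filter fun c : List.Vector Bool κm => D.run (boolPair (unaryEncodeNat n)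
          (g (x.toList ++ ρ.toList) ++ blocksStr σ ++ encZ K v))
            (c.toList.take (kap (g (x.toList ++ ρ.toList)).length)) = true).card : ℝ) := by
    unfold IdT
    rw [Finset.natCast_card_filter, Fintype.sum_prod_type, ← Finset.sum_coe_sort (S n)]
    refine Finset.sum_congr rfl fun x _ => ?_
    rw [Fintype.sum_prod_type]
    refine Finset.sum_congr rfl fun ρ _ => ?_
    rw [Fintype.sum_prod_type]
    refine Finset.sum_congr rfl fun σ _ => ?_
    rw [Fintype.sum_prod_type]
    refine Finset.sum_congr rfl fun v _ => ?_
    rw [Finset.natCast_card_filter]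
    rfl
  rw [hId]
  have hS0 : ((S n).card : ℝ) ≠ 0 := by exact_mod_cast hS.card_pos.ne'
  simp only [← Finset.sum_div, Nat.cast_mul, Nat.cast_pow, Nat.cast_ofNat, pow_add]
  field_simp

/-- **The distinguishing gap as a difference of counts** (truncated coins):
`(Pr[D real] − Pr[D ideal]) · |S_n| 2^m 2^{Kn} 2^K 2^{κ_m} = 2^K·Re − Id`. [Goldreich 2001, §2.5.3]
[cite: Goldreich2001, Thm. 2.5.6 (proof, Section 2.5.3)] -/
theorem advantage_mul_eq (hS : (S n).Nonempty)
    (hkap : ∀ x ∈ S n, ∀ ρ : List.Vector Bool mm,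
      kap (g (x.toList ++ ρ.toList)).length = D.coinLen (2 * n + 2 + ((g (x.toList ++ ρ.toList)).length + K * n + K)))
    (hκm : ∀ x ∈ S n, ∀ ρ : List.Vector Bool mm, kap (g (x.toList ++ ρ.toList)).length ≤ κm) :
    ((acceptPMF D n ((condUniform (blockSeeds S (mm + K * n) n)).map (glReal g mm K n)) true).toReal -
        (acceptPMF D n ((condUniform (blockSeeds S (mm + K * n + K) n)).map (glIdeal g mm n)) true).toReal) *
        ((S n).card * 2 ^ mm * 2 ^ (K * n) * 2 ^ K * 2 ^ κm) =
      2 ^ K * (ReT D g S kap n mm K κm : ℝ) - IdT D g S kap n mm K κm := by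
  rw [sub_mul, ← prReal_mul_eq hS hkap hκm, ← prIdeal_mul_eq hS hkap hκm]
  ring

end Counts

/-! ### The sign-adjusted function, the gap and the success probability of `𝒜_GL` -/

section Success

variable (D : RandAlg (List Bool) Bool)

/-- **The sign-adjusted distinguisher reading truncated coins**, for the input `y`:
`sgn ⊕ D(1ⁿ, y ‖ blocks σ ‖ bits u; c↾kap(|y|))`. [cite: Goldreich2001, Thm. 2.5.6 (proof, Section 2.5.3)] -/
def DfST (kap : ℕ → ℕ) (n K κm : ℕ) (sgn : Bool) (y : List Bool) (σ : Fin K → BVec n) (u : BVec K)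
    (c : List.Vector Bool κm) : Bool :=
  Bool.xor sgn (D.run (boolPair (unaryEncodeNat n) (y ++ blocksStr σ ++ encZ K u)) (c.toList.take (kap y.length)))

/-- The sign-adjusted `DfT` at level `n` for the input map `y = g(x‖ρ)`. [folklore] -/
def DfTX (g : List Bool → List Bool) (S : ∀ n : ℕ, Finset (List.Vector Bool n)) (kap : ℕ → ℕ) (n mm K κm : ℕ) (sgn : Bool)
    (x : ↥(S n)) (ρ : List.Vector Bool mm) (σ : Fin K → BVec n) (u : BVec K) (c : List.Vector Bool κm) : Bool :=
  DfST D kap n K κm sgn (g (x.1.toList ++ ρ.toList)) σ u c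

variable {D}

/-- On truncated coins the sign-adjusted function is `GLInv.DfS`. [folklore] -/
theorem DfST_eq_DfS {kap : ℕ → ℕ} {n K κm : ℕ} (sgn : Bool) (y : List Bool) (h : kap y.length ≤ κm) :
    DfST D kap n K κm sgn y = fun σ u c => DfS D n K sgn y σ u (takeV h c) := rfl

/-- With `sgn = false` the function is the plain `DfT`. [folklore] -/
theorem DfTX_false (g : List Bool → List Bool) (S : ∀ n : ℕ, Finset (List.Vector Bool n)) (kap : ℕ → ℕ) (n mm K κm : ℕ) :
    DfTX D g S kap n mm K κm false = DfT D g S kap n mm K κm := by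
  funext x ρ σ u c
  simp [DfTX, DfST, DfT, List.append_assoc]

/-- With `sgn = true` the function is the complement. [folklore] -/
theorem DfTX_true (g : List Bool → List Bool) (S : ∀ n : ℕ, Finset (List.Vector Bool n)) (kap : ℕ → ℕ) (n mm K κm : ℕ)
    (x : ↥(S n)) (ρ : List.Vector Bool mm) (σ : Fin K → BVec n) (u : BVec K) (c : List.Vector Bool κm) :
    DfTX D g S kap n mm K κm true x ρ σ u c = !(DfT D g S kap n mm K κm x ρ σ u c) := by
  simp [DfTX, DfST, DfT, List.append_assoc]

/-- **The gap of the math layer for the sign-adjusted function equals `|Pr[real] − Pr[ideal]|`**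
(times the normaliser `|S_n| 2^m 2^{Kn} 2^K 2^{κ_m}`), choosing `sgn = [Pr real < Pr ideal]`; truncated coins.
[cite: Goldreich2001, Thm. 2.5.6 (proof, Section 2.5.3)] -/
theorem gap_mul_eq (g : List Bool → List Bool) (S : ∀ n : ℕ, Finset (List.Vector Bool n)) {kap : ℕ → ℕ} {n mm K κm : ℕ}
    (hS : (S n).Nonempty)
    (hkap : ∀ x ∈ S n, ∀ ρ : List.Vector Bool mm,
      kap (g (x.toList ++ ρ.toList)).length = D.coinLen (2 * n + 2 + ((g (x.toList ++ ρ.toList)).length + K * n + K)))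
    (hκm : ∀ x ∈ S n, ∀ ρ : List.Vector Bool mm, kap (g (x.toList ++ ρ.toList)).length ≤ κm) :
    let PrR := (acceptPMF D n ((condUniform (blockSeeds S (mm + K * n) n)).map (glReal g mm K n)) true).toReal
    let PrI := (acceptPMF D n ((condUniform (blockSeeds S (mm + K * n + K) n)).map (glIdeal g mm n)) true).toReal
    |PrR - PrI| * ((S n).card * 2 ^ mm * 2 ^ (K * n) * 2 ^ K * 2 ^ κm) =
      2 ^ K * ((univ.filter fun q : ↥(S n) × List.Vector Bool mm × (Fin K → BVec n) × List.Vector Bool κm =>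
          DfTX D g S kap n mm K κm (decide (PrR < PrI)) q.1 q.2.1 q.2.2.1 (fun j => GLEns.sec S n q.1 ⬝ᵥ q.2.2.1 j) q.2.2.2 = true).card : ℝ) -
        ((univ.filter fun q : ↥(S n) × List.Vector Bool mm × (Fin K → BVec n) × BVec K × List.Vector Bool κm =>
          DfTX D g S kap n mm K κm (decide (PrR < PrI)) q.1 q.2.1 q.2.2.1 q.2.2.2.1 q.2.2.2.2 = true).card : ℝ) := by
  intro PrR PrI
  have hadv := advantage_mul_eq (D := D) (g := g) (S := S) (kap := kap) (n := n) (mm := mm) (K := K) (κm := κm) hS hkap hκm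
  change (PrR - PrI) * _ = _ at hadv
  by_cases hlt : PrR < PrI
  · -- complemented distinguisher
    simp only [hlt, decide_true]
    rw [abs_of_neg (sub_neg.2 hlt)]
    have hRe : ((univ.filter fun q : ↥(S n) × List.Vector Bool mm × (Fin K → BVec n) × List.Vector Bool κm =>
          DfTX D g S kap n mm K κm true q.1 q.2.1 q.2.2.1 (fun j => GLEns.sec S n q.1 ⬝ᵥ q.2.2.1 j) q.2.2.2 = true).card : ℝ) =
        (S n).card * 2 ^ mm * 2 ^ (K * n) * 2 ^ κm - ReT D g S kap n mm K κm := by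
      rw [eq_sub_iff_add_eq, ReT]
      have h := Finset.card_filter_add_card_filter_not (s := (univ : Finset (↥(S n) × List.Vector Bool mm × (Fin K → BVec n) × List.Vector Bool κm)))
        (fun q => DfT D g S kap n mm K κm q.1 q.2.1 q.2.2.1 (fun j => GLEns.sec S n q.1 ⬝ᵥ q.2.2.1 j) q.2.2.2 = true)
      rw [add_comm] at h
      have hc : Fintype.card (↥(S n) × List.Vector Bool mm × (Fin K → BVec n) × List.Vector Bool κm) =
          (S n).card * 2 ^ mm * 2 ^ (K * n) * 2 ^ κm := by
        simp only [Fintype.card_prod, Fintype.card_coe, card_vector, Fintype.card_bool, Fintype.card_fun, Fintype.card_fin]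
        simp [ZMod.card, ← pow_mul, mul_comm K n]; ring
      rw [Finset.card_univ, hc] at h
      have h' : ((univ.filter fun q : ↥(S n) × List.Vector Bool mm × (Fin K → BVec n) × List.Vector Bool κm =>
            DfTX D g S kap n mm K κm true q.1 q.2.1 q.2.2.1 (fun j => GLEns.sec S n q.1 ⬝ᵥ q.2.2.1 j) q.2.2.2 = true).card) =
          (univ.filter fun q : ↥(S n) × List.Vector Bool mm × (Fin K → BVec n) × List.Vector Bool κm =>
            ¬ (DfT D g S kap n mm K κm q.1 q.2.1 q.2.2.1 (fun j => GLEns.sec S n q.1 ⬝ᵥ q.2.2.1 j) q.2.2.2 = true)).card := by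
        congr 1; refine Finset.filter_congr fun q _ => ?_; rw [DfTX_true]; simp
      rw [h']
      exact_mod_cast h
    have hId : ((univ.filter fun q : ↥(S n) × List.Vector Bool mm × (Fin K → BVec n) × BVec K × List.Vector Bool κm =>
          DfTX D g S kap n mm K κm true q.1 q.2.1 q.2.2.1 q.2.2.2.1 q.2.2.2.2 = true).card : ℝ) =
        (S n).card * 2 ^ mm * 2 ^ (K * n) * 2 ^ K * 2 ^ κm - IdT D g S kap n mm K κm := by
      rw [eq_sub_iff_add_eq, IdT]
      have h := Finset.card_filter_add_card_filter_not (s := (univ : Finset (↥(S n) × List.Vector Bool mm × (Fin K → BVec n) × BVec K × List.Vector Bool κm)))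
        (fun q => DfT D g S kap n mm K κm q.1 q.2.1 q.2.2.1 q.2.2.2.1 q.2.2.2.2 = true)
      rw [add_comm] at h
      have hc : Fintype.card (↥(S n) × List.Vector Bool mm × (Fin K → BVec n) × BVec K × List.Vector Bool κm) =
          (S n).card * 2 ^ mm * 2 ^ (K * n) * 2 ^ K * 2 ^ κm := by
        simp only [Fintype.card_prod, Fintype.card_coe, card_vector, Fintype.card_bool, Fintype.card_fun, Fintype.card_fin]
        simp [ZMod.card, ← pow_mul, mul_comm K n]; ring
      rw [Finset.card_univ, hc] at h
      have h' : ((univ.filter fun q : ↥(S n) × List.Vector Bool mm × (Fin K → BVec n) × BVec K × List.Vector Bool κm =>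
            DfTX D g S kap n mm K κm true q.1 q.2.1 q.2.2.1 q.2.2.2.1 q.2.2.2.2 = true).card) =
          (univ.filter fun q : ↥(S n) × List.Vector Bool mm × (Fin K → BVec n) × BVec K × List.Vector Bool κm =>
            ¬ (DfT D g S kap n mm K κm q.1 q.2.1 q.2.2.1 q.2.2.2.1 q.2.2.2.2 = true)).card := by
        congr 1; refine Finset.filter_congr fun q _ => ?_; rw [DfTX_true]; simp
      rw [h']
      exact_mod_cast h
    rw [hRe, hId]
    linarith [hadv]
  · simp only [hlt, decide_false]
    rw [abs_of_nonneg (sub_nonneg.2 (not_lt.1 hlt)), DfTX_false]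
    exact hadv

/-- The per-input success count of the math layer, summed over the inputs, is the count of
`GLPred.inverter_count` (truncated coins). [folklore] -/
theorem sum_succ_eq (g : List Bool → List Bool) (S : ∀ n : ℕ, Finset (List.Vector Bool n)) (kap : ℕ → ℕ)
    (n mm K k κm : ℕ) (sgn : Bool) :
    (∑ x ∈ S n, ∑ ρ : List.Vector Bool mm,
      ((univ.filter fun t : GLPred.Coins n K (List.Vector Bool κm) × (Fin k → BVec n) × (Fin k → ZMod 2) =>
        glCandidate (fun r => GLPred.predB (DfST D kap n K κm sgn (g (x.toList ++ ρ.toList))) t.1 r) k t.2.1 t.2.2 = toZ x).card : ℝ)) =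
      ((univ.filter fun t : (↥(S n) × List.Vector Bool mm × GLPred.Coins n K (List.Vector Bool κm)) × (Fin k → BVec n) × (Fin k → ZMod 2) =>
        glCandidate (fun r => GLPred.predB (DfTX D g S kap n mm K κm sgn t.1.1 t.1.2.1) t.1.2.2 r) k t.2.1 t.2.2 = GLEns.sec S n t.1.1).card : ℝ) := by
  classical
  rw [Finset.natCast_card_filter, Fintype.sum_prod_type, Fintype.sum_prod_type, ← Finset.sum_coe_sort (S n)]
  refine Finset.sum_congr rfl fun x _ => ?_
  rw [Fintype.sum_prod_type]
  refine Finset.sum_congr rfl fun ρ _ => ?_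
  rw [Finset.natCast_card_filter, Fintype.sum_prod_type]
  rfl

/-- **Per input, the success count over truncated coins is `2^{κ_m − κ}` times the count over `D`'s
true coin length `κ = kap(|y|)`.** [folklore] -/
theorem card_succ_trunc {kap : ℕ → ℕ} {n K k κm : ℕ} (sgn : Bool) (y : List Bool) (x0 : BVec n) (h : kap y.length ≤ κm) :
    (univ.filter fun t : GLPred.Coins n K (List.Vector Bool κm) × (Fin k → BVec n) × (Fin k → ZMod 2) =>
        glCandidate (fun r => GLPred.predB (DfST D kap n K κm sgn y) t.1 r) k t.2.1 t.2.2 = x0).card =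
      2 ^ (κm - kap y.length) *
        (univ.filter fun t : GLPred.Coins n K (List.Vector Bool (kap y.length)) × (Fin k → BVec n) × (Fin k → ZMod 2) =>
          glCandidate (fun r => GLPred.predB (DfS D n K sgn y) t.1 r) k t.2.1 t.2.2 = x0).card := by
  classical
  rw [← card_filter_trunc h (fun t : GLPred.Coins n K (List.Vector Bool (kap y.length)) × (Fin k → BVec n) × (Fin k → ZMod 2) =>
    glCandidate (fun r => GLPred.predB (DfS D n K sgn y) t.1 r) k t.2.1 t.2.2 = x0)]
  rfl

variable (D) (qD : Polynomial ℕ) (d e : ℕ)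

/-- **The success probability of the Goldreich–Levin inverter, general output lengths.** At a level
`n` with `S_n ≠ ∅`, a bound `κ_m` on `D`'s coin counts `κ(y) = coinLen_D(L_in(n, |y|))` over the
inputs `y = g(x‖ρ)` of the level, a coin budget of the form `1 + K + 1 + Kn + K + κ(y) + kn + k + W(y)`
decoding to `κ(y)` (mod `K_b(n, |y|)`) on each input `⟨1ⁿ, y⟩`, and a gap
`δ ≤ |Pr[D real] − Pr[D ideal]|` with `n ≤ 2(δ/2^{K+1})²(2^k − 1)`:
`hidingProb g 𝒜_GL S m n ≥ δ / (4·2^K·2^k)`. [cite: Goldreich2001, Thm. 2.5.6 (proof, Section 2.5.3)] -/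
theorem hidingProb_ge_gen (g : List Bool → List Bool) (S : ∀ n : ℕ, Finset (List.Vector Bool n)) (m : ℕ → ℕ)
    {n κm : ℕ} (cl : ℕ → ℕ) {δ : ℝ} (hS : (S n).Nonempty)
    (hκm : ∀ x ∈ S n, ∀ ρ : List.Vector Bool (m n), D.coinLen (Lin d n (g (x.toList ++ ρ.toList)).length) ≤ κm)
    (hcl : ∀ x ∈ S n, ∀ ρ : List.Vector Bool (m n), ∃ W : ℕ,
      cl (2 * n + 2 + (g (x.toList ++ ρ.toList)).length) =
          1 + (Kof d n + (1 + (Kof d n * n + (Kof d n + (D.coinLen (Lin d n (g (x.toList ++ ρ.toList)).length) +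
            (kof e n * n + (kof e n + W))))))) ∧
        (1 + (Kof d n + (1 + (Kof d n * n + (Kof d n + (D.coinLen (Lin d n (g (x.toList ++ ρ.toList)).length) +
            (kof e n * n + (kof e n + W)))))))) % Kb qD d n (g (x.toList ++ ρ.toList)).length =
          D.coinLen (Lin d n (g (x.toList ++ ρ.toList)).length))
    (hk : 0 < kof e n) (hδ : 0 < δ)
    (hδle : δ ≤ distAdvantage D (glRealEns g S m d) (glIdealEns g S m d) n)
    (hm : (n : ℝ) ≤ 2 * (δ / 2 ^ Kof d n / 2) ^ 2 * (2 ^ kof e n - 1 : ℕ)) :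
    δ / (4 * 2 ^ Kof d n * 2 ^ kof e n) ≤ hidingProb g (alg D qD d e cl) S m n := by
  classical
  set K := Kof d n with hKdef
  set k := kof e n with hkdef
  set kap : ℕ → ℕ := fun ℓ => D.coinLen (Lin d n ℓ) with hkapdef
  set PrR := (acceptPMF D n ((condUniform (blockSeeds S (m n + K * n) n)).map (glReal g (m n) K n)) true).toReal with hPrR
  set PrI := (acceptPMF D n ((condUniform (blockSeeds S (m n + K * n + K) n)).map (glIdeal g (m n) n)) true).toReal with hPrI
  set sgn : Bool := decide (PrR < PrI) with hsgn
  set B : ℝ := 2 * 2 ^ K * 2 * 2 ^ (K * n) * 2 ^ K * 2 ^ (k * n) * 2 ^ k with hB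
  have hBpos : 0 < B := by rw [hB]; positivity
  have hadv_eq : distAdvantage D (glRealEns g S m d) (glIdealEns g S m d) n = |PrR - PrI| := rfl
  have hkap : ∀ x ∈ S n, ∀ ρ : List.Vector Bool (m n),
      kap (g (x.toList ++ ρ.toList)).length = D.coinLen (2 * n + 2 + ((g (x.toList ++ ρ.toList)).length + K * n + K)) :=
    fun x _ ρ => rfl
  have hκm' : ∀ x ∈ S n, ∀ ρ : List.Vector Bool (m n), kap (g (x.toList ++ ρ.toList)).length ≤ κm := hκm
  -- Step 1: each input's success probability
  have hS0 : (0 : ℝ) < (S n).card := by exact_mod_cast hS.card_pos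
  have hstep : ∀ x ∈ S n, ∀ ρ : List.Vector Bool (m n),
      1 / (B * 2 ^ κm) * ((univ.filter fun t : GLPred.Coins n K (List.Vector Bool κm) × (Fin k → BVec n) × (Fin k → ZMod 2) =>
          glCandidate (fun r => GLPred.predB (DfST D kap n K κm sgn (g (x.toList ++ ρ.toList))) t.1 r) k t.2.1 t.2.2 = toZ x).card : ℝ) ≤
        (alg D qD d e cl).pr id (boolPair (unaryEncodeNat n) (g (x.toList ++ ρ.toList))) {z | z = x.toList} := by
    intro x hx ρ
    obtain ⟨W, hclW, hmodW⟩ := hcl x hx ρ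
    have hκle : kap (g (x.toList ++ ρ.toList)).length ≤ κm := hκm x hx ρ
    set y := g (x.toList ++ ρ.toList) with hy
    set κ := kap y.length with hκdef
    set C := 1 + (K + (1 + (K * n + (K + (κ + (k * n + (k + W))))))) with hCdef
    have hlen : (alg D qD d e cl).coinLen (id (boolPair (unaryEncodeNat n) y)).length = C := by
      show cl (boolPair (unaryEncodeNat n) y).length = C
      rw [length_boolPair, show (unaryEncodeNat n).length = n from unary_decode_encode_nat n, hclW]
    rw [(alg D qD d e cl).pr_eq_card_filter_div id _ {z | z = x.toList} hlen, card_succ_trunc (D := D) sgn y (toZ x) hκle]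
    have h := card_success_ge D qD d e x y sgn W hmodW
    have h' : ((2 ^ W * (univ.filter fun t : GLPred.Coins n K (List.Vector Bool κ) × (Fin k → BVec n) × (Fin k → ZMod 2) =>
        glCandidate (fun r => GLPred.predB (DfS D n K sgn y) t.1 r) k t.2.1 t.2.2 = toZ x).card : ℕ) : ℝ) ≤
        ((univ.filter fun coins : List.Vector Bool C =>
          run D qD d e (boolPair (unaryEncodeNat n) y) coins.toList = x.toList).card : ℝ) := by
      exact_mod_cast h
    push_cast at h' ⊢
    have h2 : (2 : ℝ) ^ κm = 2 ^ (κm - κ) * 2 ^ κ := by rw [← pow_add, Nat.sub_add_cancel hκle]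
    have hC2 : (2 : ℝ) ^ C = B * 2 ^ κ * 2 ^ W := by
      rw [hCdef, hB]; simp only [pow_add, pow_one]; ring
    rw [hC2, h2, le_div_iff₀ (by positivity)]
    calc 1 / (B * (2 ^ (κm - κ) * 2 ^ κ)) * (2 ^ (κm - κ) * ((univ.filter fun t : GLPred.Coins n K (List.Vector Bool κ) ×
          (Fin k → BVec n) × (Fin k → ZMod 2) => glCandidate (fun r => GLPred.predB (DfS D n K sgn y) t.1 r) k t.2.1 t.2.2 = toZ x).card : ℝ)) *
          (B * 2 ^ κ * 2 ^ W) =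
        2 ^ W * ((univ.filter fun t : GLPred.Coins n K (List.Vector Bool κ) × (Fin k → BVec n) × (Fin k → ZMod 2) =>
          glCandidate (fun r => GLPred.predB (DfS D n K sgn y) t.1 r) k t.2.1 t.2.2 = toZ x).card : ℝ) := by
          field_simp
      _ ≤ _ := h'.trans (le_of_eq (by congr 2))
  -- Step 2: sum over the inputs
  have hsum : 1 / (B * 2 ^ κm) *
      ((univ.filter fun t : (↥(S n) × List.Vector Bool (m n) × GLPred.Coins n K (List.Vector Bool κm)) × (Fin k → BVec n) × (Fin k → ZMod 2) =>
        glCandidate (fun r => GLPred.predB (DfTX D g S kap n (m n) K κm sgn t.1.1 t.1.2.1) t.1.2.2 r) k t.2.1 t.2.2 = GLEns.sec S n t.1.1).card : ℝ) ≤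
      ∑ x ∈ S n, ∑ ρ : List.Vector Bool (m n), (alg D qD d e cl).pr id (boolPair (unaryEncodeNat n) (g (x.toList ++ ρ.toList))) {z | z = x.toList} := by
    rw [← sum_succ_eq, Finset.mul_sum]
    refine Finset.sum_le_sum fun x hx => ?_
    rw [Finset.mul_sum]
    exact Finset.sum_le_sum fun ρ _ => hstep x hx ρ
  -- Step 3: the math layer
  have hcount := GLPred.inverter_count (X := ↥(S n)) (R := List.Vector Bool (m n)) (C := List.Vector Bool κm)
    (DfTX D g S kap n (m n) K κm sgn) (GLEns.sec S n) hδ ?_ hk hm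
  swap
  · -- the gap hypothesis
    have hgap := gap_mul_eq (D := D) g S (kap := kap) (mm := m n) (K := K) (κm := κm) hS hkap hκm'
    change |PrR - PrI| * _ = _ at hgap
    rw [← hgap]
    have hcard : (Fintype.card ↥(S n) * Fintype.card (List.Vector Bool (m n)) * Fintype.card (Fin K → BVec n) * (2 : ℝ) ^ K *
        Fintype.card (List.Vector Bool κm)) = (S n).card * 2 ^ m n * 2 ^ (K * n) * 2 ^ K * 2 ^ κm := by
      simp only [Fintype.card_coe, card_vector, Fintype.card_bool, Fintype.card_fun, Fintype.card_fin]
      simp [ZMod.card, ← pow_mul, mul_comm K n]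
    rw [hcard]
    exact mul_le_mul_of_nonneg_right (hadv_eq ▸ hδle) (by positivity)
  -- Step 4: arithmetic
  unfold hidingProb
  rw [le_div_iff₀ (by positivity)]
  refine le_trans ?_ hsum
  have htot : (Fintype.card ((↥(S n) × List.Vector Bool (m n) × GLPred.Coins n K (List.Vector Bool κm)) ×
      (Fin k → BVec n) × (Fin k → ZMod 2)) : ℝ) =
      (S n).card * 2 ^ m n * (2 ^ K * (2 * (2 ^ (K * n) * (2 ^ K * 2 ^ κm)))) * 2 ^ (k * n) * 2 ^ k := by
    rw [Fintype.card_prod, Fintype.card_prod, Fintype.card_prod, GLPred.card_Coins, Fintype.card_prod]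
    simp only [Fintype.card_coe, card_vector, Fintype.card_bool, Fintype.card_fun, Fintype.card_fin, ZMod.card]
    push_cast
    simp [← pow_mul, mul_comm K n, mul_comm k n]
    ring
  rw [htot] at hcount
  have h2K : (0 : ℝ) < 2 ^ K := by positivity
  have h2k : (0 : ℝ) < 2 ^ k := by positivity
  calc δ / (4 * 2 ^ K * 2 ^ k) * ((S n).card * 2 ^ m n)
      = 1 / (B * 2 ^ κm) *
          (δ / 2 ^ K / 2 / 2 ^ k * ((S n).card * 2 ^ m n * (2 ^ K * (2 * (2 ^ (K * n) * (2 ^ K * 2 ^ κm)))) * 2 ^ (k * n) * 2 ^ k)) := by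
        rw [hB]
        field_simp
        ring
    _ ≤ _ := mul_le_mul_of_nonneg_left hcount (by positivity)

end Success

/-! ### The coin budget: advice on `(n, |y|)` along a sparse sequence of levels -/

section Budget

variable (D : RandAlg (List Bool) Bool) (qD : Polynomial ℕ) (d e : ℕ) (g : List Bool → List Bool)
  (S : ∀ n : ℕ, Finset (List.Vector Bool n)) (m : ℕ → ℕ)

/-- **The largest output length of `g` on the seeds of level `n`** (finitely many). [folklore] -/
def maxLen (n : ℕ) : ℕ :=
  (S n ×ˢ (univ : Finset (List.Vector Bool (m n)))).sup fun q => (g (q.1.toList ++ q.2.toList)).length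

/-- **The largest coin count of `D`** on the samples of level `n`. [folklore] -/
def κmax (n : ℕ) : ℕ :=
  (S n ×ˢ (univ : Finset (List.Vector Bool (m n)))).sup fun q => D.coinLen (Lin d n (g (q.1.toList ++ q.2.toList)).length)

/-- `D`'s coin count on the samples of level `n` with `|y| = ℓ`. [folklore] -/
def κT (n ℓ : ℕ) : ℕ := D.coinLen (Lin d n ℓ)

/-- **The coin count encoding the advice** `κ(n, ℓ)`: `κ(n, ℓ) + K_b(n, ℓ) · Room(n)`. [folklore] -/
def CodeT (n ℓ : ℕ) : ℕ := κT D d n ℓ + Kb qD d n ℓ * Room d e n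

/-- The spread of the selection: all input lengths `2n + 2 + |g(x‖ρ)|` of level `n` lie in
`[n, 2n + 2 + maxLen(n)]`. [folklore] -/
def wl (n : ℕ) : ℕ := 2 * n + 2 + maxLen g S m n

/-- **The coin budget of `𝒜_GL`**: on input length `l`, select the level `n = sel l` and read off
`|y| = l − (2n + 2)`; hand out `Code(n, |y|)` coins (`0` if `l < 2n + 2`). [folklore] -/
noncomputable def clT (Gs : ℕ → Prop) (l : ℕ) : ℕ :=
  if 2 * Yao.sel Gs (wl g S m) l + 2 ≤ l then
    CodeT D qD d e (Yao.sel Gs (wl g S m) l) (l - (2 * Yao.sel Gs (wl g S m) l + 2)) else 0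

variable {D qD d e g S m}

/-- Output lengths lie below `maxLen`. [folklore] -/
theorem length_le_maxLen {n : ℕ} {x : List.Vector Bool n} (hx : x ∈ S n) (ρ : List.Vector Bool (m n)) :
    (g (x.toList ++ ρ.toList)).length ≤ maxLen g S m n := by
  unfold maxLen
  exact Finset.le_sup (f := fun q : List.Vector Bool n × List.Vector Bool (m n) => (g (q.1.toList ++ q.2.toList)).length)
    (b := (x, ρ)) (Finset.mem_product.2 ⟨hx, Finset.mem_univ ρ⟩)

/-- Coin counts lie below `κmax`. [folklore] -/
theorem coinLen_le_κmax {n : ℕ} {x : List.Vector Bool n} (hx : x ∈ S n) (ρ : List.Vector Bool (m n)) :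
    D.coinLen (Lin d n (g (x.toList ++ ρ.toList)).length) ≤ κmax D d g S m n := by
  unfold κmax
  exact Finset.le_sup (f := fun q : List.Vector Bool n × List.Vector Bool (m n) => D.coinLen (Lin d n (g (q.1.toList ++ q.2.toList)).length))
    (b := (x, ρ)) (Finset.mem_product.2 ⟨hx, Finset.mem_univ ρ⟩)

/-- `n ≤ wl n`. [folklore] -/
theorem wl_ge (n : ℕ) : n ≤ wl g S m n := by unfold wl; omega

/-- `κ(n, ℓ) < K_b(n, ℓ)` for a bound `q_D` on `D`'s coin count. [folklore] -/
theorem κT_lt (hqD : ∀ l, D.coinLen l ≤ qD.eval l) (n ℓ : ℕ) : κT D d n ℓ < Kb qD d n ℓ := by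
  unfold κT Kb; exact Nat.lt_succ_of_le (hqD _)

/-- **The coin budget is polynomially bounded** (in the input length), when the good levels are
unbounded and positive: the same polynomial `clPolyGL` as in the fixed-length case. [folklore] -/
theorem clT_le (hqD : ∀ l, D.coinLen l ≤ qD.eval l) {Gs : ℕ → Prop} (hG : ∀ a, ∃ b, a ≤ b ∧ Gs b) (hG1 : ∀ n, Gs n → 1 ≤ n)
    (l : ℕ) : clT D qD d e g S m Gs l ≤ (clPolyGL qD d e).eval l := by
  unfold clT
  split_ifs with h
  · set n := Yao.sel Gs (wl g S m) l with hn
    set ℓ := l - (2 * n + 2) with hℓ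
    have hnl : n ≤ l := by omega
    have hpos : 1 ≤ n := hG1 n (Yao.seqN_good hG _)
    have hK := Kof_le d n
    have hk := kof_le hpos e
    have hKn : Kof d n * n ≤ d * l ^ 2 := by
      calc Kof d n * n ≤ d * n * n := Nat.mul_le_mul_right _ hK
        _ ≤ d * l * l := Nat.mul_le_mul (Nat.mul_le_mul_left _ hnl) hnl
        _ = d * l ^ 2 := by ring
    have hKl : Kof d n ≤ d * l := hK.trans (Nat.mul_le_mul_left _ hnl)
    have hLinEq : Lin d n ℓ = l + Kof d n * n + Kof d n := by
      unfold Lin; omega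
    have hLin : Lin d n ℓ ≤ l + d * l ^ 2 + d * l := by rw [hLinEq]; omega
    have hKb : Kb qD d n ℓ ≤ qD.eval (l + d * l ^ 2 + d * l) + 1 := Nat.succ_le_succ (TM2Iter.eval_mono qD hLin)
    have hκ : κT D d n ℓ ≤ qD.eval (l + d * l ^ 2 + d * l) + 1 := ((κT_lt hqD n ℓ).le).trans hKb
    have hRoom : Room d e n ≤ 2 + 2 * d * l + d * l ^ 2 + (2 * e + 3) * l ^ 2 + (2 * e + 3) * l := by
      unfold Room
      have h3 : kof e n * n ≤ (2 * e + 3) * l ^ 2 := by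
        calc kof e n * n ≤ (2 * e + 3) * n * n := Nat.mul_le_mul_right _ hk
          _ ≤ (2 * e + 3) * l * l := Nat.mul_le_mul (Nat.mul_le_mul_left _ hnl) hnl
          _ = (2 * e + 3) * l ^ 2 := by ring
      have h4 : kof e n ≤ (2 * e + 3) * l := hk.trans (Nat.mul_le_mul_left _ hnl)
      have h1 : 2 * Kof d n ≤ 2 * d * l := by rw [mul_assoc]; exact Nat.mul_le_mul_left 2 hKl
      omega
    have hev : (clPolyGL qD d e).eval l = (qD.eval (l + d * l ^ 2 + d * l) + 1) *
        (1 + (2 + 2 * d * l + d * l ^ 2 + (2 * e + 3) * l ^ 2 + (2 * e + 3) * l)) := by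
      simp [clPolyGL, eval_comp]
    rw [hev]
    unfold CodeT
    calc κT D d n ℓ + Kb qD d n ℓ * Room d e n
        ≤ (qD.eval (l + d * l ^ 2 + d * l) + 1) + (qD.eval (l + d * l ^ 2 + d * l) + 1) * (2 + 2 * d * l + d * l ^ 2 + (2 * e + 3) * l ^ 2 + (2 * e + 3) * l) :=
          Nat.add_le_add hκ (Nat.mul_le_mul hKb hRoom)
      _ = (qD.eval (l + d * l ^ 2 + d * l) + 1) * (1 + (2 + 2 * d * l + d * l ^ 2 + (2 * e + 3) * l ^ 2 + (2 * e + 3) * l)) := by ring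
  · exact Nat.zero_le _

/-- **On the input lengths of a selected level the budget is `Code(n, |y|)`.** [folklore] -/
theorem clT_eq {Gs : ℕ → Prop} (hG : ∀ a, ∃ b, a ≤ b ∧ Gs b) (j : ℕ) {ℓ : ℕ} (hℓ : ℓ ≤ maxLen g S m (Yao.seqN Gs (wl g S m) j)) :
    clT D qD d e g S m Gs (2 * Yao.seqN Gs (wl g S m) j + 2 + ℓ) = CodeT D qD d e (Yao.seqN Gs (wl g S m) j) ℓ := by
  set n := Yao.seqN Gs (wl g S m) j
  have hsel : Yao.sel Gs (wl g S m) (2 * n + 2 + ℓ) = n :=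
    Yao.sel_eq hG wl_ge (by omega) (by show 2 * n + 2 + ℓ ≤ 2 * n + 2 + maxLen g S m n; omega)
  unfold clT
  rw [hsel, if_pos (by omega), show 2 * n + 2 + ℓ - (2 * n + 2) = ℓ by omega]

/-- `Code(n, ℓ)` has the shape required by `hidingProb_ge_gen`: `1 + K + 1 + Kn + K + κ + kn + k + W` with
`W = (K_b − 1)·Room`, and it decodes to `κ`. [folklore] -/
theorem CodeT_eq (hqD : ∀ l, D.coinLen l ≤ qD.eval l) (n ℓ : ℕ) :
    CodeT D qD d e n ℓ = 1 + (Kof d n + (1 + (Kof d n * n + (Kof d n + (κT D d n ℓ + (kof e n * n + (kof e n +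
      (Kb qD d n ℓ - 1) * Room d e n))))))) ∧
    CodeT D qD d e n ℓ % Kb qD d n ℓ = κT D d n ℓ := by
  have hκ := κT_lt (d := d) hqD n ℓ
  constructor
  · unfold CodeT Room
    obtain ⟨B, hB⟩ : ∃ B, Kb qD d n ℓ = B + 1 := ⟨Kb qD d n ℓ - 1, by omega⟩
    rw [hB, Nat.add_sub_cancel]
    ring
  · unfold CodeT
    rw [Nat.add_mul_mod_self_left, Nat.mod_eq_of_lt hκ]

end Budget

end GLGen

/-! ### The theorem -/

open GLGen in
/-- **The Goldreich–Levin theorem for hiding functions, `O(log n)` bits — discharge of the named fact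
`goldreichLevin_hiding`, with no proviso on the output length of `g`.** For every family
`𝒮 = {S_n ⊆ {0,1}ⁿ}` of eventually nonempty sets, every randomized `g(x ‖ ρ)` (`|ρ| = m(n)`, any output
lengths) and every `d`: if `g` is `𝒮`-hiding then `{g(x‖ρ) ‖ σ ‖ GL_{d⌊log₂ n⌋}(x, σ)}` and
`{g(x‖ρ) ‖ σ ‖ U_{d⌊log₂ n⌋}}` are computationally indistinguishable. Proof: if a PPT `D` has advantage
`≥ 1/n^c` infinitely often, run `𝒜_GL` (`e = c + d`, `D`'s coin polynomial `q_D`) with the budget `clT`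
(advice `κ(n, |y|)` read off the input length `2n + 2 + |y|` along the sparse sequence `Yao.seqN` of good
levels with spread `2n + 2 + maxLen(n)`); it is PPT (`clT_le`, `GLInv.glInvRun_polyTime_holds`) and
recovers `x ← S_n` with probability `≥ 1/n^{3(c+d)+2}` at every selected level (`hidingProb_ge_gen`
with `κ_m = κmax(n)`, `clT_eq`, `CodeT_eq`, `GLInv.queries_ge`, `GLInv.bound_ge`), contradicting hiding.
[O. Goldreich, L. Levin, STOC 1989; Goldreich 2001, Thm 2.5.6 with §2.5.2; Y. Liu, R. Pass, FOCS 2020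
(arXiv:2009.11514), Appendix A, Thm [GL89] ("also see Theorem 2.12 in [HHR06]")]
[cite: LiuPassFOCS2020, Appendix (Thm [GL89], hardcore functions for S-hiding f)] -/
theorem goldreichLevin_hiding_holds : goldreichLevin_hiding := by
  intro S g m d hne hhid D hD
  by_contra hneg
  obtain ⟨c, hfreq⟩ := exists_frequently_ge_of_not_superpolynomialDecay' (fun n => distAdvantage_nonneg D _ _ n) hneg
  obtain ⟨qD, hqD⟩ := hD.2
  -- good levels
  set Gs : ℕ → Prop := fun n => 1 / (n : ℝ) ^ c ≤ distAdvantage D (glRealEns g S m d) (glIdealEns g S m d) n ∧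
    2 ^ (2 * (c + d) + 4) ≤ n ∧ (S n).Nonempty with hGs
  have hGsf : ∃ᶠ n in atTop, Gs n := hfreq.and_eventually ((eventually_ge_atTop _).and hne)
  have hG' : ∀ a, ∃ b, a ≤ b ∧ Gs b := fun a => by
    obtain ⟨b, hb, hGb⟩ := frequently_atTop.1 hGsf a
    exact ⟨b, hb, hGb⟩
  -- the inverter with the advice-carrying coin budget is PPT
  set A' := GLInv.alg D qD d (c + d) (clT D qD d (c + d) g S m Gs) with hA'
  have hPPT : IsPPT A' id := by
    refine ⟨?_, ⟨GLInv.clPolyGL qD d (c + d), clT_le hqD hG' (fun n hn => le_trans Nat.one_le_two_pow hn.2.1)⟩⟩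
    obtain ⟨p, M, hM⟩ := GLInv.glInvRun_polyTime_holds D qD d (c + d) hD
    exact ⟨p, M, fun a => hM a⟩
  -- hiding: eventually `< 1/n^{3(c+d)+2}`
  have hev : ∀ᶠ n : ℕ in atTop, hidingProb g A' S m n < 1 / (n : ℝ) ^ (3 * (c + d) + 2) :=
    (isNegligible_iff_eventually_lt_of_nonneg (fun n => hidingProb_nonneg g A' S m n)).1 (hhid A' hPPT) _
  obtain ⟨N₁, hN₁⟩ := eventually_atTop.1 hev
  set n := Yao.seqN Gs (wl g S m) N₁ with hn
  have hNn : N₁ ≤ n := (Yao.seqN_strictMono hG' wl_ge).id_le N₁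
  obtain ⟨hgood, hbig, hSn⟩ := Yao.seqN_good (w := wl g S m) hG' N₁
  have hn1 : 1 ≤ n := le_trans Nat.one_le_two_pow hbig
  -- the counting bound at `n`
  have hmain := hidingProb_ge_gen D qD d (c + d) g S m (n := n) (κm := κmax D d g S m n)
    (clT D qD d (c + d) g S m Gs) (δ := 1 / (n : ℝ) ^ c) hSn (fun x hx ρ => coinLen_le_κmax hx ρ)
    (fun x hx ρ => by
      obtain ⟨hCode, hmod⟩ := CodeT_eq (D := D) (qD := qD) (d := d) (e := c + d) hqD n (g (x.toList ++ ρ.toList)).length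
      simp only [κT] at hCode hmod
      refine ⟨(GLInv.Kb qD d n (g (x.toList ++ ρ.toList)).length - 1) * GLInv.Room d (c + d) n, ?_, ?_⟩
      · rw [← hCode]; exact clT_eq hG' N₁ (length_le_maxLen hx ρ)
      · rw [← hCode]; exact hmod)
    (by unfold GLInv.kof; omega) (by positivity) hgood (GLInv.queries_ge hn1)
  have h1 := hN₁ n hNn
  have h2 := GLInv.bound_ge (c := c) (d := d) hn1 hbig
  linarith

end Literature.Computability.Cryptography
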